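import Summits.Langlands.Langlands.Theses.MonomialConverse

/-!
# Birth skeleton (BC3) — crux `MonomialInduction` of route `MonomialConverse`

Crux item `stmt-Langlands-18581`, decl
`Summit.Langlands.Langlands.Theses.MonomialConverse.MonomialInduction` (auto-crux, conjecture-grade:
automorphic induction of an abelian-free character `λ` of `Γ_K` along an ARBITRARY finite extension
`K/F` of number fields into cuspidal pieces `π₁, …, π_r` over `F`, Satake polynomials multiplying at
almost every `v` to the arithmetic-Frobenius polynomial `∏_{w ∣ v} (X^{f(w∣v)} − λ(Frob_w))` of
`Ind_K^F λ`; known for `[K:F] ≤ 3` and along towers of cyclic prime steps, OPEN for insoluble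
Galois closures — the flagship `C₁₀, C₆, C₄ ⊂ 2.A₅` layers of the route).

## The line (the route's own: `C ⇒ C₀` through Hecke) and where it is cut

`MonomialInduction` is the special case `C₀` of the Cogdell–Piatetski-Shapiro `GL₁`-twist converse
conjecture `C = CPSConverseGL1` (the route's rank-2 crux, item `stmt-Langlands-18579`) that the glue
`MurtyGlue` consumes; the route derives it as `HeckeLambdaNice → CPSConverseGL1 → MonomialInduction`
(items `stmt-Langlands-18973`, `-18974`, `-18582`).  This skeleton cuts that derivation at its two
genuine WAYPOINTS, typed below as named `Prop`s over existing declarations: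

* `InducedNiceDatum` — **the Hecke side, in CPS currency**: for abelian-free `λ` there is a
  factorizable datum `D : TwistedStandardLData N F` (intended `N = [K:F]`, the datum of
  `Π(Ind_K^F λ)`: `α_v` = the roots of `∏_{w∣v}(X^{f_w} − λ(Frob_w))`, central character = the Hecke
  character of `det(Ind λ)`, twisted local factors `∏_{w∣v, ψ unramified}(1 − ψ(ϖ_w)X^{f_w})` for
  `ψ = λ^{Hecke}·(ω∘N_{K/F})`, Γ-shifts and `ε = W·A^{1/2−s}` regrouped from Hecke–Tate along `w ∣ v`)
  ALL of whose `GL₁`-twisted completed `L`-functions are nice (they are completed Hecke `L`-functions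
  `Λ_K(s, ψ)` of NON-norm-twist characters — abelian-freeness of `λ` is used exactly here — hence
  entire, bounded in vertical strips, with functional equation: Hecke 1920 / Tate 1950), and whose
  Satake family is the induced Frobenius family at almost every `v` (stated in the crux's own
  `c`-currency, so that no Frobenius-value function has to be chosen in the statement).
* `CuspidalSupportPolynomial` — **the automorphic side**: every automorphic `P` of `GL_N(𝔸_F)` is
  nearly equivalent to an isobaric sum of cuspidal data, on Satake POLYNOMIALS: cuspidal `π_k` on
  `GL_{d_k}(𝔸_F)` with `∏_k ∏_{b ∈ Sat(π_k,v)}(X − b) = ∏_{a ∈ Sat(P,v)}(X − a)` at almost every `v`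
  (Langlands 1979, Prop. 2 — tree named fact `Langlands1979_cuspidalSupport_satakeParams`, UNPROVED —
  plus Flath's proved `hasSatakeParamAt_cofinite_holds` / `hasSatakeParamAt_unique_holds` and
  `satakePolynomial (∑ βᵢ) = ∏ satakePolynomial βᵢ`).

The four stubs: `stub_heckeLambdaNice` (= item 18973 BY NAME: Hecke–Tate in CPS currency, the one
unproved Literature fact of the route's cone, `heckeLFunction_functional_equation`, general unitary
case), `stub_inducedNiceDatum_of_hecke : HeckeLambdaNice → InducedNiceDatum` (the Artin-formalism
half of item 18974: local Langlands for `GL₁`, inductivity of `L` and `ε`, regrouping of Euler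
products and Γ-factors along `w ∣ v`, class field theory for "abelian-free ⇒ no twist is a norm
twist"), `stub_cpsConverseGL1` (= the route's rank-2 crux BY NAME, item 18579: THE open step; it has
its own birth skeleton TwistPropagation/CPSIITheorem in the route header) and
`stub_cuspidalSupportPolynomial` (the cleanup half of item 18974).  `MonomialInduction_of` is the
kernel-checked composition (pure logic: three cofinite filters intersected), concluding the route
decl BY NAME; `heckeNiceBridgeOfLambda_of` / `heckeNiceBridge_of` record, sorry-free, that the two
new waypoints refine the route's support items 18974 / 18582.

No `Disproof.lean` exists for this crux (`ledger crux ls stmt-Langlands-18581`: no workfiles,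
2026-08-17); the refuter's birth attack (item notes) is honoured: `∃ r` is kept (r = 1 is false on a
quadratic tower), `r = 0` is excluded by degrees, Satake = ARITHMETIC-Frobenius roots.

Sources: CogdellPiatetskishapiro1994 (§2 Def. p. 165, Conjecture p. 166), HeckeMathZ1920,
TateThesis1967 (Thm. 4.4.1), LanglandsCorvallis1979Notion (Prop. 2), JacquetShalikaAJM1981II (§4),
FlathCorvallis1979 (Thm. 3), DeligneAntwerpII1973 (inductivity of local constants),
ArthurClozelAMS120 (Ch. 3 Def. 6.1: the induced Satake polynomial), CasselsFrohlichANT1967 (Ch. VII: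
norm compatibility of the Artin map).

Shape (for `ledger skeleton check` / `#h21_check_skeleton`): each stub is
`theorem stub_<name> : <statement> := by sorry`; `_Goal.stub_<name> : Prop := type_of% @stub_<name>`
names that statement; `MonomialInduction_of (h₁ … h₄ : _Goal.stub_…) : …MonomialInduction` is pure
logic (no `sorry`) and concludes the route decl BY NAME; the last `example` feeds the stubs to it.
-/

noncomputable section

open scoped BigOperators NumberField Classical MatrixGroups
open Filter IsDedekindDomain NumberField
open Literature.NumberTheory.Automorphic Literature.NumberTheory.GaloisRepresentations
open Summit.Langlands.Langlands.Theses.MonomialConverse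

-- `Summit.Langlands.Langlands.…` repeats a namespace component by design (D-0017 nested layout).
set_option linter.dupNamespace false

namespace Summit.Langlands.Langlands.Cruxes.MonomialInduction.Birth

/-! ## 0. The two waypoints -/

/-- **WAYPOINT A (Hecke side in Cogdell–Piatetski-Shapiro currency): the twisted datum of
`Π(Ind_K^F λ)` exists and all its `GL₁`-twists are nice.**  For every finite extension `K/F` of
number fields and every character `λ : Γ_K → GL₁(ℂ)` that is not the restriction of a character of
`Γ_F`, there are `N ≥ 1` (intended `N = [K:F]`) and a datum `D : TwistedStandardLData N F` such that
(i) `D.AllTwistsNice` — for EVERY Hecke character `ω` of `F` the completed twisted `L`-functions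
`Λ(s, Π ⊗ ω)`, `Λ(s, Π̃ ⊗ ω⁻¹)` are entire, bounded in vertical strips and satisfy
`Λ(s, Π ⊗ ω) = ε(s, Π ⊗ ω) Λ(1 − s, Π̃ ⊗ ω⁻¹)` (they are the completed Hecke `L`-functions of the
non-norm-twist characters `λ^{Hecke}·(ω ∘ N_{K/F})^{±1}` of `K`: Hecke 1920 / Tate), and
(ii) at almost every finite place `v` of `F`, whenever `c` records the Frobenius values of `λ` at the
places `w ∣ v` (all unramified), `∏_{a ∈ D.α v}(X − a) = ∏_{w ∣ v}(X^{f(w∣v)} − c_w)` — the Satake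
family of `D` is the arithmetic-Frobenius family of `Ind_K^F λ` (Arthur–Clozel Ch. 3 Def. 6.1).
No such datum is cheaply constructible (niceness of all twists is Hecke's theorem for `K`), and a
junk datum cannot satisfy (i)–(ii): off `D.S` the structure ties every twisted local factor to `α`.
[cite: CogdellPiatetskishapiro1994, §2 Definition (p. 165) and Conjecture (p. 166)]
[cite: HeckeMathZ1920] [cite: TateThesis1967, Thm. 4.4.1] [cite: ArthurClozelAMS120, Ch. 3 Def. 6.1] -/
def InducedNiceDatum : Prop :=
  ∀ (F K : Type) [Field F] [NumberField F] [Field K] [NumberField K] [Algebra F K]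
    (lam : FramedGaloisRep K ℂ 1), (∀ χ : FramedGaloisRep F ℂ 1, lam ≠ χ.restrictField K) →
    ∃ (N : ℕ) (D : TwistedStandardLData N F), 1 ≤ N ∧ D.AllTwistsNice ∧
      ∀ᶠ v : HeightOneSpectrum (RingOfIntegers F) in cofinite,
        ∀ c : HeightOneSpectrum (RingOfIntegers K) → ℂ,
          (∀ w : HeightOneSpectrum (RingOfIntegers K),
              w.asIdeal.under (RingOfIntegers F) = v.asIdeal →
                lam.IsUnramifiedAt w ∧ lam.HasFrobCharpolyAt w (Polynomial.X - Polynomial.C (c w))) →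
            satakePolynomial (D.α v) =
              ∏ᶠ w ∈ {w : HeightOneSpectrum (RingOfIntegers K) |
                  w.asIdeal.under (RingOfIntegers F) = v.asIdeal},
                (Polynomial.X - Polynomial.C (c w)).comp
                  (Polynomial.X ^ w.asIdeal.inertiaDeg (RingOfIntegers F))

/-- **WAYPOINT B (cuspidal support on Satake polynomials).**  For every automorphic representation
`P` of `GL_N(𝔸_F)` (Borel–Jacquet datum) there are cuspidal `π₁, …, π_r` on `GL_{d_k}(𝔸_F)` such
that at almost every finite `v`, whenever `P` has Satake parameter `α` at `v`, the `π_k` have Satake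
parameters `β_k` with `∏_k ∏_{b ∈ β_k}(X − b) = ∏_{a ∈ α}(X − a)`: `P` is a constituent of
`Ind(σ₁ ⊗ ⋯ ⊗ σ_r)` with `σ_k` cuspidal (Langlands 1979, Prop. 2; the twists `|det|^{s_k}` are again
cuspidal data in the tree's sense), so `t_{P,v} = ⊎_k t_{σ_k,v}` at the places where all are
unramified (Flath; uniqueness of Satake parameters).  In the tree: the named fact
`Langlands1979_cuspidalSupport_satakeParams` (unproved) read through
`AutomorphicRepData.hasSatakeParamAt_cofinite_holds` and `hasSatakeParamAt_unique_holds` (proved).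
Not cheaply inhabited: `r = 0` forces `satakePolynomial α = 1`, i.e. `N = 0`.
[cite: LanglandsCorvallis1979Notion, Prop. 2] [cite: JacquetShalikaAJM1981II, §4] [cite: FlathCorvallis1979, Thm. 3] -/
def CuspidalSupportPolynomial : Prop :=
  ∀ (N : ℕ) (F : Type) [Field F] [NumberField F] (hcpt : isCompact_glFiniteIntegralLevel N F)
    (P : AutomorphicRepData (AutomorphyDatum.gl N F hcpt)),
    ∃ (r : ℕ) (d : Fin r → ℕ) (hc : ∀ k, isCompact_glFiniteIntegralLevel (d k) F)
      (π : ∀ k, CuspidalAutomorphicRepData (d k) F (hc k)),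
      ∀ᶠ v : HeightOneSpectrum (RingOfIntegers F) in cofinite, ∀ α : Multiset ℂ,
        P.HasSatakeParamAt v α →
          ∃ β : Fin r → Multiset ℂ, (∀ k, (π k).1.HasSatakeParamAt v (β k)) ∧
            ∏ k, satakePolynomial (β k) = satakePolynomial α

/-! ## 1. The four stubs -/

/-- **Stub 1 (= route item `stmt-Langlands-18973` BY NAME, size L): Hecke 1920 / Tate 1950 in
Cogdell–Piatetski-Shapiro currency** — for every unitary non-norm-twist Hecke character `χ` of a number
field there are `A ∈ ℕ_{>0}`, shifts, `|W| = 1` and ENTIRE `Λ, Λ'` bounded in vertical strips with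
`Λ = γ_a · L(χ, ·)`, `Λ' = γ_{a'} · L(χ⁻¹, ·)` on `re s > 1` and `Λ(s) = W A^{1/2−s} Λ'(1−s)`.  The
analytic input of the line; its residue beyond the tree is the named fact
`heckeLFunction_functional_equation` (general unitary case; finite-order case proved).
[cite: TateThesis1967, Thm. 4.4.1] [cite: HeckeMathZ1920] -/
theorem stub_heckeLambdaNice : HeckeLambdaNice := by
  sorry

/-- **Stub 2 (size L, the Artin-formalism half of route item `stmt-Langlands-18974`): Hecke niceness
⇒ the nice induced datum.**  Build `D` for `Π(Ind_K^F λ)` (`N = [K:F]`; `S` ⊇ places below the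
ramification of `K/F` and of `λ`; `α_v` = roots of `∏_{w∣v}(X^{f_w} − λ(Frob_w))`, `|α| = 1`, card
`∑ f_w = N` by `Ideal.sum_ramification_inertia`; central character = Hecke character of `det(Ind λ)`
by `artinReciprocity_character_holds`; `twist.localFactor ω v = ∏_{w∣v, ψ_w unramified}(1 − ψ(ϖ_w)X^{f_w})`
with `ψ = λ^{Hecke}·(ω∘N_{K/F})`, which off `S` is the twisted Euler polynomial of `α_v` when `ω_v`
is unramified (`(ω∘N)(ϖ_w) = ω(ϖ_v)^{f_w}`) and `1` when `ω_v` is ramified (`N(𝒪_w^×) = 𝒪_v^×`);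
Γ-shifts, `W`, `A` regrouped from `HeckeLambdaNice` for the unitary part of `ψ` along `w ∣ v`), then
(i) `Λ(s, Π ⊗ ω) = Λ_K(s, ψ)` on a right half-plane (regrouping a multipliable Euler product,
`multipliable_heckeLFunction_holds`) and `ψ` is never a norm twist because `λ` is abelian-free (class
field theory: a finite-order `λ^{Hecke}` factoring through `N_{K/F}` comes from a finite-order
character of `C_F`, i.e. `λ` would be a restriction), so Stub 1 gives niceness; (ii) the Satake clause
is `HasFrobCharpolyAt` uniqueness at unramified `w` (`hasFrobCharpolyAt_iff_of_rank_one`).  Why it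
might fail as typed: only through the carrier's shape constraints at `v ∉ S` (checked above field by
field). [cite: CogdellPiatetskishapiro1994, §2 (pp. 161–166)] [cite: DeligneAntwerpII1973, §5]
[cite: CasselsFrohlichANT1967, Ch. VII §5] -/
theorem stub_inducedNiceDatum_of_hecke : HeckeLambdaNice → InducedNiceDatum := by
  sorry

/-- **Stub 3 (= the route's rank-2 crux `CPSConverseGL1`, item `stmt-Langlands-18579`, BY NAME;
difficulty open-problem): the Cogdell–Piatetski-Shapiro `GL₁`-twist converse conjecture** in the
analytic form over the tree's carrier — all `GL₁`-twists of `D` nice ⇒ some automorphic `P` on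
`GL_N(𝔸_K)` has Satake parameter `D.α v` at almost every `v`.  THE open step of the line (known for
`N ≤ 3`); staffed once, as the route's crux, with its own skeleton (TwistPropagation → CPSIITheorem).
[cite: CogdellPiatetskishapiro1994, §2 Conjecture (p. 166)] [cite: CogdellPiatetskishapiro1999, Thm. 2] -/
theorem stub_cpsConverseGL1 : CPSConverseGL1 := by
  sorry

/-- **Stub 4 (size M given the named fact, the cleanup half of route item `stmt-Langlands-18974`):
cuspidal support on Satake polynomials** (`CuspidalSupportPolynomial`): Langlands 1979 Prop. 2 (tree
fact `Langlands1979_cuspidalSupport_satakeParams`, unproved) + Flath (proved `hasSatakeParamAt_cofinite_holds`,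
`hasSatakeParamAt_unique_holds`) + `satakePolynomial (∑ βᵢ) = ∏ satakePolynomial βᵢ`.
[cite: LanglandsCorvallis1979Notion, Prop. 2] [cite: FlathCorvallis1979, Thm. 3] -/
theorem stub_cuspidalSupportPolynomial : CuspidalSupportPolynomial := by
  sorry

/-! ## 2. The stub statements as named `Prop`s (literally the types of the stubs; no `sorry` inherited) -/

namespace _Goal

/-- The statement of `stub_heckeLambdaNice`, as a named `Prop` (literally its type). [folklore] -/
def stub_heckeLambdaNice : Prop :=
  type_of% @Summit.Langlands.Langlands.Cruxes.MonomialInduction.Birth.stub_heckeLambdaNice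

/-- The statement of `stub_inducedNiceDatum_of_hecke`, as a named `Prop` (literally its type). [folklore] -/
def stub_inducedNiceDatum_of_hecke : Prop :=
  type_of% @Summit.Langlands.Langlands.Cruxes.MonomialInduction.Birth.stub_inducedNiceDatum_of_hecke

/-- The statement of `stub_cpsConverseGL1`, as a named `Prop` (literally its type). [folklore] -/
def stub_cpsConverseGL1 : Prop :=
  type_of% @Summit.Langlands.Langlands.Cruxes.MonomialInduction.Birth.stub_cpsConverseGL1

/-- The statement of `stub_cuspidalSupportPolynomial`, as a named `Prop` (literally its type). [folklore] -/
def stub_cuspidalSupportPolynomial : Prop :=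
  type_of% @Summit.Langlands.Langlands.Cruxes.MonomialInduction.Birth.stub_cuspidalSupportPolynomial

end _Goal

/-! ## 3. The composition (kernel-checked, no `sorry`) -/

/-- **Composition (kernel-checked, no sorry): the four stubs give the crux BY NAME.**
Given `K/F` and an abelian-free `λ`: Stub 2 (fed by Stub 1) yields `N ≥ 1` and a datum `D` with all
twists nice and induced Satake family a.e.; Stub 3 turns niceness into an automorphic `P` with
`Sat(P, v) = D.α v` a.e.; Stub 4 replaces `P` by cuspidal `π_k` with matching Satake polynomials a.e.;
intersecting the three cofinite sets gives the conclusion of `MonomialInduction` verbatim. [folklore] -/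
theorem MonomialInduction_of (h₁ : _Goal.stub_heckeLambdaNice)
    (h₂ : _Goal.stub_inducedNiceDatum_of_hecke) (h₃ : _Goal.stub_cpsConverseGL1)
    (h₄ : _Goal.stub_cuspidalSupportPolynomial) :
    Summit.Langlands.Langlands.Theses.MonomialConverse.MonomialInduction := by
  intro F K _ _ _ _ _ lam hlam
  obtain ⟨N, D, hN, hnice, hmatch⟩ := h₂ h₁ F K lam hlam
  obtain ⟨hcpt, P, hP⟩ := h₃ N F D hN hnice
  obtain ⟨r, d, hc, π, hπ⟩ := h₄ N F hcpt P
  refine ⟨r, d, hc, π, ?_⟩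
  filter_upwards [hmatch, hP, hπ] with v hv₁ hv₂ hv₃ c hc'
  obtain ⟨β, hβ, hprod⟩ := hv₃ (D.α v) hv₂
  exact ⟨β, hβ, hprod.trans (hv₁ c hc')⟩

/-- The two new waypoints refine the route's support item `HeckeNiceBridgeOfLambda`
(`stmt-Langlands-18974`): Stub 2 and Stub 4 give it outright (sorry-free). [folklore] -/
theorem heckeNiceBridgeOfLambda_of (h₂ : _Goal.stub_inducedNiceDatum_of_hecke)
    (h₄ : _Goal.stub_cuspidalSupportPolynomial) :
    Summit.Langlands.Langlands.Theses.MonomialConverse.HeckeNiceBridgeOfLambda := by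
  intro h₁ h₃ F K _ _ _ _ _ lam hlam
  obtain ⟨N, D, hN, hnice, hmatch⟩ := h₂ h₁ F K lam hlam
  obtain ⟨hcpt, P, hP⟩ := h₃ N F D hN hnice
  obtain ⟨r, d, hc, π, hπ⟩ := h₄ N F hcpt P
  refine ⟨r, d, hc, π, ?_⟩
  filter_upwards [hmatch, hP, hπ] with v hv₁ hv₂ hv₃ c hc'
  obtain ⟨β, hβ, hprod⟩ := hv₃ (D.α v) hv₂
  exact ⟨β, hβ, hprod.trans (hv₁ c hc')⟩

/-- Likewise for the binder `HeckeNiceBridge` of the route's `closes` (`stmt-Langlands-18582`):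
Stubs 1, 2, 4 give `CPSConverseGL1 → MonomialInduction` (sorry-free). [folklore] -/
theorem heckeNiceBridge_of (h₁ : _Goal.stub_heckeLambdaNice)
    (h₂ : _Goal.stub_inducedNiceDatum_of_hecke) (h₄ : _Goal.stub_cuspidalSupportPolynomial) :
    Summit.Langlands.Langlands.Theses.MonomialConverse.HeckeNiceBridge :=
  fun h₃ => heckeNiceBridgeOfLambda_of h₂ h₄ h₁ h₃

/-- By-name sanity check (an `example`, not a declaration of the file): the four stubs feed the
composition as they stand. -/
example : Summit.Langlands.Langlands.Theses.MonomialConverse.MonomialInduction :=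
  MonomialInduction_of stub_heckeLambdaNice stub_inducedNiceDatum_of_hecke stub_cpsConverseGL1
    stub_cuspidalSupportPolynomial

end Summit.Langlands.Langlands.Cruxes.MonomialInduction.Birth

end
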